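import Summits.AnomalousDissipation.AnomalousDissipation.Theorems.BaireTransferRobustLoudUpgradeLine

/-!
# Line `malkin-cone-group-orbits` of the crux `BaireTransfer.RobustLoudUpgrade` (stmt-AnomalousDissipation-1144): the conserved-mean
LEAVES and the maximal tame union (lead's reshape v4)

Companion of `Theorems/BaireTransferRobustLoudUpgradeLine.lean` (vocabulary, classes, composition of the line): definitions
`SteadyPersistsInLeaf`, `nondegSteadyLeaf`, `persistSteadyLeaf`, `tameLeaf`, the sorry-free composition `RobustLoudUpgrade_of_leaf` /
registered sub-goal `line_glue_v4`, and `tame_subset_tameLeaf_of` (the v4 residual is weaker than the v2/v3 one given Henry's theorem).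
No facts are asserted.  References: Temam (1979) Ch. II §1; Henry (1981) Ch. 8; the route file `Theses/BaireTransfer.lean` (item 1144);
refuter note `Cruxes/RobustLoudUpgrade/DREFUTE-tameDense-galilean-drift.md` (why leaves).
-/

-- `Summit.<Summit>.<Problem>` is the tree's mandated summit-side namespace (CONVENTIONS §2); for this
-- single-conjunct summit the two coincide, so the duplicate is deliberate.
set_option linter.dupNamespace false

noncomputable section

open scoped BigOperators Topology
open Filter Set Function TopologicalSpace MeasureTheory

/-! ## §7 Reshape v4 (lead, 2026-08-16, after wave 2): the conserved-mean LEAVES, and the maximal tame union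

Wave 2 landed `stub_malkinBordered`, `stub_borderedCone` (so the Malkin lever `malkinSteady ⊆ closure (interior loud)` is a
theorem), `stub_periodicWindow`, the residual's small-data regime `smallData_mem_censusSteady`, the Literature fact
`Literature.Analysis.FluidPDE.PeriodicNSOrbitPersists` (Henry 1981) with the reduction `periodicPersist_of_henry`, and the Literature
layer `SteadyNSLatticePersistenceDrift` (`steadyPersistsInLeaf_of_nondeg`: persistence of a leaf-nondegenerate classical steady state
of ANY mean, in its conserved-mean leaf).  The line's refuter had shown (Cruxes/RobustLoudUpgrade/DREFUTE-tameDense-galilean-drift.md)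
that restricting steady witnesses to mean ZERO makes the residual stronger than the crux needs (Galilean-drift steady loud witnesses of
the shear force at every Grashof number).  Hence the final classes below: steady witnesses of ANY mean persisting in their leaf, and
the MAXIMAL tame union `tameLeaf` = every class whose upgrade to `closure (interior LOUD)` is a LANDED theorem once the two leaf
stubs land — `nondegSteadyLeaf ⊆ persistSteadyLeaf` (leaf IFT) and `persistSteadyLeaf ⊆ interior loud` (leaf window).  The periodic
nondegeneracy class enters only through `persistPeriodic` (its own upgrade `nondegPeriodic ⊆ persistPeriodic` is Henry's theorem,
filed as Literature debt and NOT used by the composition `line_glue_v4`). -/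

namespace Summit.AnomalousDissipation.AnomalousDissipation.Theorems.RobustLoudUpgrade

open Literature.Analysis.FunctionSpaces Literature.Analysis.FunctionSpaces.Torus
open Literature.Analysis.FluidPDE
open Summit.AnomalousDissipation.AnomalousDissipation.Theses.BaireTransfer

/-- **Persistence of a steady state IN ITS CONSERVED-MEAN LEAF under change of the force, at fixed viscosity**: for every
`δ > 0` all forces `f_{c'}`, `c'` near `c`, carry a classical steady state `u'` of `NS_ν` with the SAME spatial mean as `u₀` within
squared `H¹`-distance `δ` of `u₀` (the conclusion of `Literature.Analysis.FluidPDE.SteadyLatticeDrift.steadyPersistsInLeaf_of_nondeg`,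
stated in the line's vocabulary). [folklore] -/
@[folklore] def SteadyPersistsInLeaf (S : Finset (Fin 3 → ℤ)) (c : Coeff S) (ν : ℝ)
    (u₀ : UnitAddTorus (Fin 3) → EuclideanSpace ℝ (Fin 3)) : Prop :=
  ∀ δ : ℝ, 0 < δ → ∃ r : ℝ, 0 < r ∧ ∀ c' : Coeff S, dist c' c < r →
    ∃ (u' : UnitAddTorus (Fin 3) → EuclideanSpace ℝ (Fin 3)) (p' : UnitAddTorus (Fin 3) → ℝ),
      Torus.IsSteadyNSState ν (force S c') u' p' ∧ (∫ x, u' x) = (∫ x, u₀ x) ∧ h1DistSq u' u₀ < δ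

/-- **Leaf-nondegenerate loud steady witnesses of ANY mean** (`nondegSteady` without `HasZeroMean u₀`; the kernel condition
`¬ IsLinNSEigenvalue ν u₀ 0` is over mean-zero `w`, i.e. nondegeneracy in the conserved-mean leaf of `u₀`). [folklore] -/
def nondegSteadyLeaf (S : Finset (Fin 3 → ℤ)) (a E ε : ℝ) : Set (Coeff S) :=
  {c | ∃ ν : ℝ, 0 < ν ∧ ν < a ∧ ∃ (u₀ : UnitAddTorus (Fin 3) → EuclideanSpace ℝ (Fin 3)) (p₀ : UnitAddTorus (Fin 3) → ℝ),
    Torus.IsSteadyNSState ν (force S c) u₀ p₀ ∧ meanEnergy (fun _ : ℝ => u₀) < E ∧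
      ε < meanDissipation ν (fun _ : ℝ => u₀) ∧ ¬ Torus.IsLinNSEigenvalue ν u₀ 0}

/-- **Leaf-persistent loud steady witnesses of ANY mean** (`persistSteady` with persistence in the leaf of `u₀`). [folklore] -/
def persistSteadyLeaf (S : Finset (Fin 3 → ℤ)) (a E ε : ℝ) : Set (Coeff S) :=
  {c | ∃ ν : ℝ, 0 < ν ∧ ν < a ∧ ∃ (u₀ : UnitAddTorus (Fin 3) → EuclideanSpace ℝ (Fin 3)) (p₀ : UnitAddTorus (Fin 3) → ℝ),
    Torus.IsSteadyNSState ν (force S c) u₀ p₀ ∧ meanEnergy (fun _ : ℝ => u₀) < E ∧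
      ε < meanDissipation ν (fun _ : ℝ => u₀) ∧ SteadyPersistsInLeaf S c ν u₀}

/-- **The maximal tame union** (reshape v4): every witness class of the line whose upgrade to `closure (interior LOUD)` is a
landed theorem (given the two leaf stubs) — leaf-nondegenerate / leaf-persistent steady witnesses of any mean, the strict steady census
at one viscosity, Malkin-visible Goldstone circles and bordered steady persistence, persistent periodic orbits. [folklore] -/
def tameLeaf (S : Finset (Fin 3 → ℤ)) (a E ε : ℝ) : Set (Coeff S) :=
  nondegSteadyLeaf S a E ε ∪ persistSteadyLeaf S a E ε ∪ censusSteady S a E ε ∪ malkinSteady S a E ε ∪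
    borderedSteady S a E ε ∪ persistPeriodic S a E ε

/-- The maximal tame union lies in `closure (interior LOUD)` at the same (strict) budgets, given the upgrade theorems. [folklore] -/
theorem tameLeaf_subset_closure_interior
    (h₁ : ∀ (S : Finset (Fin 3 → ℤ)) (a E ε : ℝ), nondegSteadyLeaf S a E ε ⊆ persistSteadyLeaf S a E ε)
    (h₁' : ∀ (S : Finset (Fin 3 → ℤ)) (a E ε : ℝ), persistSteadyLeaf S a E ε ⊆ interior (loud S a E ε))
    (h₀ : ∀ (S : Finset (Fin 3 → ℤ)) (a E ε : ℝ), censusSteady S a E ε ⊆ interior (loud S a E ε))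
    (h₂ : ∀ (S : Finset (Fin 3 → ℤ)) (a E ε : ℝ), malkinSteady S a E ε ⊆ borderedSteady S a E ε)
    (h₂' : ∀ (S : Finset (Fin 3 → ℤ)) (a E ε : ℝ), borderedSteady S a E ε ⊆ closure (interior (loud S a E ε)))
    (h₃' : ∀ (S : Finset (Fin 3 → ℤ)) (a E ε : ℝ), persistPeriodic S a E ε ⊆ interior (loud S a E ε))
    (S : Finset (Fin 3 → ℤ)) (a E ε : ℝ) :
    tameLeaf S a E ε ⊆ closure (interior (loud S a E ε)) := by
  refine Set.union_subset (Set.union_subset (Set.union_subset (Set.union_subset (Set.union_subset ?_ ?_) ?_) ?_) ?_) ?_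
  · exact ((h₁ S a E ε).trans (h₁' S a E ε)).trans subset_closure
  · exact (h₁' S a E ε).trans subset_closure
  · exact (h₀ S a E ε).trans subset_closure
  · exact (h₂ S a E ε).trans (h₂' S a E ε)
  · exact h₂' S a E ε
  · exact (h₃' S a E ε).trans subset_closure

/-- **Composition, reshape v4**: the upgrade theorems of the maximal tame union and the residual over `tameLeaf` prove the crux BY
NAME (`S₀ := unitStock`; `closure` is monotone and idempotent). [folklore] -/
theorem RobustLoudUpgrade_of_leaf
    (h₁ : ∀ (S : Finset (Fin 3 → ℤ)) (a E ε : ℝ), nondegSteadyLeaf S a E ε ⊆ persistSteadyLeaf S a E ε)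
    (h₁' : ∀ (S : Finset (Fin 3 → ℤ)) (a E ε : ℝ), persistSteadyLeaf S a E ε ⊆ interior (loud S a E ε))
    (h₀ : ∀ (S : Finset (Fin 3 → ℤ)) (a E ε : ℝ), censusSteady S a E ε ⊆ interior (loud S a E ε))
    (h₂ : ∀ (S : Finset (Fin 3 → ℤ)) (a E ε : ℝ), malkinSteady S a E ε ⊆ borderedSteady S a E ε)
    (h₂' : ∀ (S : Finset (Fin 3 → ℤ)) (a E ε : ℝ), borderedSteady S a E ε ⊆ closure (interior (loud S a E ε)))
    (h₃' : ∀ (S : Finset (Fin 3 → ℤ)) (a E ε : ℝ), persistPeriodic S a E ε ⊆ interior (loud S a E ε))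
    (h₅ : ∀ S : Finset (Fin 3 → ℤ), unitStock ⊆ S → ∀ (a E ε : ℝ), 0 < a → 0 < ε →
      loud S a E ε ⊆ closure (tameLeaf S a (2 * E) (ε / 2))) :
    RobustLoudUpgrade := by
  refine ⟨unitStock, fun S hS E ε hε j => ?_⟩
  have ha : (0 : ℝ) < 1 / ((j : ℝ) + 1) := by positivity
  intro c hc
  have hcl := h₅ S hS (1 / ((j : ℝ) + 1)) E ε ha hε hc
  have hsub := tameLeaf_subset_closure_interior h₁ h₁' h₀ h₂ h₂' h₃' S (1 / ((j : ℝ) + 1)) (2 * E) (ε / 2)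
  exact closure_minimal hsub isClosed_closure hcl

/-- **Line glue, reshape v4 (curried; the registered sub-goal `line_glue_v4`).** [folklore] -/
theorem line_glue_v4 : (∀ (S : Finset (Fin 3 → ℤ)) (a E ε : ℝ), nondegSteadyLeaf S a E ε ⊆ persistSteadyLeaf S a E ε) → (∀ (S : Finset (Fin 3 → ℤ)) (a E ε : ℝ), persistSteadyLeaf S a E ε ⊆ interior (loud S a E ε)) → (∀ (S : Finset (Fin 3 → ℤ)) (a E ε : ℝ), censusSteady S a E ε ⊆ interior (loud S a E ε)) → (∀ (S : Finset (Fin 3 → ℤ)) (a E ε : ℝ), malkinSteady S a E ε ⊆ borderedSteady S a E ε) → (∀ (S : Finset (Fin 3 → ℤ)) (a E ε : ℝ), borderedSteady S a E ε ⊆ closure (interior (loud S a E ε))) → (∀ (S : Finset (Fin 3 → ℤ)) (a E ε : ℝ), persistPeriodic S a E ε ⊆ interior (loud S a E ε)) → (∀ S : Finset (Fin 3 → ℤ), unitStock ⊆ S → ∀ (a E ε : ℝ), 0 < a → 0 < ε → loud S a E ε ⊆ closure (tameLeaf S a (2 * E) (ε / 2))) → RobustLoudUpgrade :=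
  fun h₁ h₁' h₀ h₂ h₂' h₃' h₅ => RobustLoudUpgrade_of_leaf h₁ h₁' h₀ h₂ h₂' h₃' h₅

/-- The old tame union is part of the maximal one, except for its periodic summand, which enters through Henry's theorem
(`nondegPeriodic ⊆ persistPeriodic`): so the v4 residual is WEAKER than the v2/v3 residual given that fact. [folklore] -/
theorem tame_subset_tameLeaf_of
    (h₃ : ∀ (S : Finset (Fin 3 → ℤ)) (a E ε : ℝ), nondegPeriodic S a E ε ⊆ persistPeriodic S a E ε)
    (S : Finset (Fin 3 → ℤ)) (a E ε : ℝ) : tame S a E ε ⊆ tameLeaf S a E ε := by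
  rintro c (((hN | hC) | hM) | hP)
  · obtain ⟨ν, hν, hνa, u₀, p₀, hst, -, hE, hε, hnd⟩ := hN
    exact Or.inl (Or.inl (Or.inl (Or.inl (Or.inl ⟨ν, hν, hνa, u₀, p₀, hst, hE, hε, hnd⟩))))
  · exact Or.inl (Or.inl (Or.inl (Or.inr hC)))
  · exact Or.inl (Or.inl (Or.inr hM))
  · exact Or.inr (h₃ S a E ε hP)

end Summit.AnomalousDissipation.AnomalousDissipation.Theorems.RobustLoudUpgrade

end
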